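import Mathlib
import HarnessLib
import Summits.ResolutionOfSingularities.ResolutionOfSingularities.Theorems.WildQuotientsWildQuotientResolutionS1aLogExitFramesLocPrep

/-!
# Line L exit — part 4/5: homogeneous regular system of parameters [C] and the Kato ideal [D]

[OURS · L1 W4.5c · idea-1 g10/g11; plan-1 RULING (F1)/(γ′) SHAPE v1 2026-08-27T20:12:52Z; memos
`L/res-L1-w45c-idea-1/f1/F1-SHAPE.md` … `F1-SHAPE-v4.md`] — NOT statements of the manuscript; counted 0;
AI-written and AI-reviewed only (weaker than expert review). Crux stmt-ResolutionOfSingularities-17941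
(`WildQuotients.CyclicQuotientFourfolds`), skeleton line `s1a-logminvertex`, stubs `stub_localGame` (EXIT half:
the `S1.LogExitZone` clause of `S1.KillOrExitModel`) / `stub_logExitPatching`. This is PART 4/5 of the helper
module v3 (single-file form `f1/S1aLogExitFrames.lean` sha16 44731ecda72d117c, 1518 lines, split along its §
boundaries for the gate's per-file size cap; declarations byte-identical, one namespace
`…Theorems.WildQuotientResolution.S1.LogExitFrames` across the parts). No `sorry`, no `instance`, no `notation`;
Literature notions (`augmentationIdeal`, `invariantSubring`, `LogChart.*`, `Scheme.IsLogRegular`) are CITED, not restated.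

* §8 (REAL) `exists_homogeneous_generators`: for `A = B^σ` regular local (instance binder; discharged by
  Király–Lütkebohmert in part 5) and (R-triv), graded Nakayama (`span_homogeneous_maximalIdeal_eq_top` + Mathlib's
  `IsLocalRing.CotangentSpace.span_image_eq_top_iff`, `exists_linearIndependent`) gives `d = spanFinrank 𝔪_A`
  HOMOGENEOUS generators `s : Fin d → A` of `𝔪_A` with characters `χ : Fin d → ι`.
* §9 (REAL) `span_coneMonomials_eq_maximalIdeal`: in `A₀ = degZeroInvariants 𝒜 σ` the ideal generated by the
  non-trivial cone monomials `s^m` (`m ≠ 0`, `Σ m_i • χ_i = 0`) IS `𝔪_{A₀}` — descending induction on `Σ m_i ≤ |ι|·d`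
  (`coneMonomials_step`: peel `s_i^{|ι|}`, or expand a degree-`c` invariant along `s` and project to degree `c`).
-/

set_option linter.dupNamespace false

noncomputable section

open CategoryTheory AlgebraicGeometry TopologicalSpace
open Literature.AlgebraicGeometry.Resolution

namespace Summit.ResolutionOfSingularities.ResolutionOfSingularities.Theorems.WildQuotientResolution.S1.LogExitFrames

/-! ## §8 Toward `F1Loc`: a homogeneous regular system of parameters of `B^σ` [C] (REAL, v3) -/

section HomogeneousRSP

open DirectSum IsLocalRing

variable {ι : Type*} [DecidableEq ι] [AddCommGroup ι] {B : Type*} [CommRing B] [IsLocalRing B]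
  (𝒜 : ι → AddSubgroup B) [GradedRing 𝒜] (σ : B ≃+* B)

/-- Under (R-triv), the HOMOGENEOUS elements of `𝔪_{B^σ}` span it (graded + (R-triv) ⇒ every
homogeneous component of an element of `𝔪_{B^σ}` is again in `𝔪_{B^σ}`). [OURS · L1 W4.5c] -/
theorem span_homogeneous_maximalIdeal_eq_top [IsLocalRing (invariantSubring σ)]
    (hσ : ∀ c : ι, ∀ b ∈ 𝒜 c, σ b ∈ 𝒜 c)
    (hR : ∀ c : ι, c ≠ 0 → ∀ b ∈ 𝒜 c, b ∈ maximalIdeal B) :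
    Submodule.span (invariantSubring σ)
      {x : maximalIdeal (invariantSubring σ) | ∃ c : ι, ((x : invariantSubring σ) : B) ∈ 𝒜 c} = ⊤ := by
  classical
  rw [eq_top_iff]
  rintro x -
  have hxA : ((x : invariantSubring σ) : B) ∈ invariantSubring σ := (x : invariantSubring σ).2
  have hxB : ((x : invariantSubring σ) : B) ∈ maximalIdeal B :=
    (mem_maximalIdeal_invariantSubring_iff σ _).1 x.2
  have hcomp : ∀ c, ((decompose 𝒜 ((x : invariantSubring σ) : B)) c : B) ∈ invariantSubring σ :=
    fun c => coe_decompose_mem_invariantSubring 𝒜 σ hσ hxA c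
  have hcomp𝔪 : ∀ c, (⟨_, hcomp c⟩ : invariantSubring σ) ∈ maximalIdeal (invariantSubring σ) :=
    fun c => (mem_maximalIdeal_invariantSubring_iff σ _).2
      (coe_decompose_mem_maximalIdeal 𝒜 hR hxB c)
  have hx : x = ∑ c ∈ (decompose 𝒜 ((x : invariantSubring σ) : B)).support,
      (⟨⟨_, hcomp c⟩, hcomp𝔪 c⟩ : maximalIdeal (invariantSubring σ)) := by
    apply Subtype.ext
    apply Subtype.ext
    rw [AddSubmonoidClass.coe_finsetSum, AddSubmonoidClass.coe_finsetSum]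
    exact (sum_support_decompose 𝒜 _).symm
  rw [hx]
  exact Submodule.sum_mem _ fun c _ => Submodule.subset_span ⟨c, (decompose 𝒜 _ c).2⟩

/-- **[C] (graded Nakayama).** Under (R-triv), the regular local invariant ring `A = B^σ` has a
regular system of parameters consisting of HOMOGENEOUS elements: `d = spanFinrank 𝔪_A`
homogeneous elements whose classes form a basis of `𝔪_A/𝔪_A²`, hence generating `𝔪_A`.
[OURS · L1 W4.5c; Mathlib `IsLocalRing.CotangentSpace.span_image_eq_top_iff`] -/
theorem exists_homogeneous_generators [IsRegularLocalRing (invariantSubring σ)]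
    (hσ : ∀ c : ι, ∀ b ∈ 𝒜 c, σ b ∈ 𝒜 c)
    (hR : ∀ c : ι, c ≠ 0 → ∀ b ∈ 𝒜 c, b ∈ maximalIdeal B) :
    ∃ (s : Fin (maximalIdeal (invariantSubring σ)).spanFinrank → invariantSubring σ)
      (χ : Fin (maximalIdeal (invariantSubring σ)).spanFinrank → ι),
      (∀ i, ((s i : invariantSubring σ) : B) ∈ 𝒜 (χ i)) ∧
      Ideal.span (Set.range s) = maximalIdeal (invariantSubring σ) := by
  classical
  set A := invariantSubring σ with hAdef
  set d := (maximalIdeal A).spanFinrank with hddef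
  set H : Set (maximalIdeal A) := {x | ∃ c : ι, ((x : A) : B) ∈ 𝒜 c} with hHdef
  have hH : Submodule.span A H = ⊤ := span_homogeneous_maximalIdeal_eq_top 𝒜 σ hσ hR
  have hHκ : Submodule.span (ResidueField A) ((maximalIdeal A).toCotangent '' H) = ⊤ :=
    CotangentSpace.span_image_eq_top_iff.mpr hH
  obtain ⟨b, hb, hbspan, hbli⟩ :=
    exists_linearIndependent (ResidueField A) ((maximalIdeal A).toCotangent '' H)
  rw [hHκ] at hbspan
  have hbfin : b.Finite := hbli.set_finite_of_isNoetherian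
  letI : Fintype b := hbfin.fintype
  have hsp : ⊤ ≤ Submodule.span (ResidueField A) (Set.range ((↑) : b → CotangentSpace A)) := by
    rw [Subtype.range_coe, hbspan]
  let bas := Module.Basis.mk hbli hsp
  have hcard : Fintype.card b = d := by
    rw [hddef, spanFinrank_maximalIdeal_eq_finrank_cotangentSpace, Module.finrank_eq_card_basis bas]
  let e : Fin d ≃ b := (Fintype.equivFinOfCardEq hcard).symm
  have hch : ∀ j : b, ∃ h ∈ H, (maximalIdeal A).toCotangent h = (j : CotangentSpace A) :=
    fun j => hb j.2
  choose g hgH hg using hch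
  have hspan' : Submodule.span A (Set.range fun i : Fin d => g (e i)) = ⊤ := by
    apply CotangentSpace.span_image_eq_top_iff.mp
    have himg : (maximalIdeal A).toCotangent '' Set.range (fun i : Fin d => g (e i)) = b := by
      ext v
      constructor
      · rintro ⟨_, ⟨i, rfl⟩, rfl⟩
        rw [hg]
        exact (e i).2
      · intro hv
        refine ⟨g (e (e.symm ⟨v, hv⟩)), ⟨_, rfl⟩, ?_⟩
        rw [hg, Equiv.apply_symm_apply]
    rw [himg, hbspan]
  have hgH' : ∀ i : Fin d, ∃ c : ι, (((g (e i) : maximalIdeal A) : A) : B) ∈ 𝒜 c :=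
    fun i => hgH (e i)
  choose χ hχ using hgH'
  refine ⟨fun i => (g (e i) : A), χ, hχ, ?_⟩
  have hmap := congr_arg (Submodule.map (maximalIdeal A).subtype) hspan'
  rw [Submodule.map_span, Submodule.map_top, Submodule.range_subtype, ← Set.range_comp] at hmap
  exact hmap

end HomogeneousRSP

/-! ## §9 Toward `F1Loc`: the Kato ideal of the cone chart is `𝔪_{A₀}` [D] (REAL, v3)

With `s, χ` as in §8 put `f i := (s i : B)` and let `T ⊆ A₀ := B₀^σ` be the set of cone monomials
`∏ f i ^ m i` with `m : Fin d → ℕ`, `m ≠ 0`, `∑ m i • χ i = 0`.  KEY LEMMA: `𝔪_{A₀} ⊆ (T)`.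
Proof: by descending induction on `∑ m i` (bounded by `N d`, `N = |ι|`) one shows that every
`a · f^m` with `a ∈ A` homogeneous of degree `-(∑ m i • χ i)` (and `a ∈ 𝔪_B` if `m = 0`) lies in
`(T) · A₀`: if some `m i ≥ N` peel off the generator `f i ^ N ∈ T` (`N • χ i = 0`); if `m ≠ 0`
and `∑ m i • χ i = 0` then `f^m ∈ T`; otherwise `a ∈ 𝔪_B` ((R-triv) or the hypothesis), so
`a = ∑ cf i · f i` in `A` and, projecting to the degree of `a`, `a = ∑ b i · f i` with `b i ∈ A`
homogeneous — recurse on `b i · f^(m + e_i)`. -/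

section KatoIdeal

open DirectSum IsLocalRing

variable {ι : Type*} [DecidableEq ι] [AddCommGroup ι] [Fintype ι] {B : Type*} [CommRing B]
  [IsLocalRing B] (𝒜 : ι → AddSubgroup B) [GradedRing 𝒜] (σ : B ≃+* B)

omit [DecidableEq ι] [Fintype ι] [IsLocalRing B] [GradedRing 𝒜] in
/-- Bookkeeping: raising the `i`-th exponent by `n` multiplies the monomial `∏ f j ^ m j` by `f i ^ n`. -/
theorem prod_pow_add_ite {d : ℕ} (f : Fin d → B) (m : Fin d → ℕ) (i : Fin d) (n : ℕ) :
    ∏ j, f j ^ (m j + if j = i then n else 0) = (∏ j, f j ^ m j) * f i ^ n := by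
  have h : ∀ j ∈ (Finset.univ : Finset (Fin d)),
      f j ^ (m j + if j = i then n else 0) = f j ^ m j * f j ^ (if j = i then n else 0) :=
    fun j _ => pow_add _ _ _
  rw [Finset.prod_congr rfl h, Finset.prod_mul_distrib]
  congr 1
  rw [Finset.prod_eq_single i (fun j _ hji => by rw [if_neg hji, pow_zero])
    (fun hi => absurd (Finset.mem_univ i) hi), if_pos rfl]

omit [DecidableEq ι] [Fintype ι] [IsLocalRing B] [GradedRing 𝒜] in
/-- Bookkeeping: raising the `i`-th exponent by `n` raises the total degree `∑ m j` by `n`. -/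
theorem sum_add_ite {d : ℕ} (m : Fin d → ℕ) (i : Fin d) (n : ℕ) :
    ∑ j, (m j + if j = i then n else 0) = (∑ j, m j) + n := by
  simp [Finset.sum_add_distrib, Finset.sum_ite_eq']

omit [DecidableEq ι] [Fintype ι] in
/-- Bookkeeping: raising the `i`-th exponent by `n` adds `n • χ i` to the character `∑ m j • χ j`. -/
theorem sum_add_ite_smul {d : ℕ} (χ : Fin d → ι) (m : Fin d → ℕ) (i : Fin d) (n : ℕ) :
    ∑ j, (m j + if j = i then n else 0) • χ j = (∑ j, m j • χ j) + n • χ i := by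
  simp [add_nsmul, Finset.sum_add_distrib, ite_smul, Finset.sum_ite_eq']

variable {d : ℕ} (s : Fin d → invariantSubring σ) (χ : Fin d → ι)

omit [Fintype ι] [IsLocalRing B] in
/-- A monomial `∏ s i ^ m i` in homogeneous invariants of degrees `χ i` is homogeneous of degree `∑ m i • χ i`. -/
theorem prod_pow_mem_graded_of (hs : ∀ i, ((s i : invariantSubring σ) : B) ∈ 𝒜 (χ i))
    (m : Fin d → ℕ) : ∏ i, ((s i : invariantSubring σ) : B) ^ m i ∈ 𝒜 (∑ i, m i • χ i) :=
  SetLike.prod_pow_mem_graded 𝒜 χ (fun i => ((s i : invariantSubring σ) : B)) m fun i _ => hs i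

omit [DecidableEq ι] [AddCommGroup ι] [Fintype ι] [IsLocalRing B] [GradedRing 𝒜] in
/-- A monomial in invariants is an invariant. -/
theorem prod_pow_mem_invariantSubring (m : Fin d → ℕ) :
    ∏ i, ((s i : invariantSubring σ) : B) ^ m i ∈ invariantSubring σ :=
  Subring.prod_mem _ fun i _ => Subring.pow_mem _ (s i).2 _

/-- The non-trivial CONE MONOMIALS `∏ (s i)^(m i)` (`m ≠ 0`, `∑ m i • χ i = 0`), viewed in the
degree-`0` invariant ring `A₀ = B₀^σ`. [OURS · L1 W4.5c] -/
def coneMonomials : Set (degZeroInvariants 𝒜 σ) :=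
  {y | ∃ m : Fin d → ℕ, m ≠ 0 ∧ ∑ i, m i • χ i = 0 ∧
    (y : B) = ∏ i, ((s i : invariantSubring σ) : B) ^ m i}

/-- One step of the descending induction behind `𝔪_{A₀} ⊆ (cone monomials)` (see the section
docstring). [OURS · L1 W4.5c] -/
theorem coneMonomials_step [IsLocalRing (invariantSubring σ)]
    (hσ : ∀ c : ι, ∀ b ∈ 𝒜 c, σ b ∈ 𝒜 c)
    (hR : ∀ c : ι, c ≠ 0 → ∀ b ∈ 𝒜 c, b ∈ maximalIdeal B)
    (hs : ∀ i, ((s i : invariantSubring σ) : B) ∈ 𝒜 (χ i))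
    (hspan : Ideal.span (Set.range s) = maximalIdeal (invariantSubring σ))
    (m : Fin d → ℕ)
    (ih : ∀ m' : Fin d → ℕ, Fintype.card ι * d - ∑ j, m' j < Fintype.card ι * d - ∑ j, m j →
      ∀ (a : B) (c : ι), a ∈ invariantSubring σ → a ∈ 𝒜 c → c + ∑ j, m' j • χ j = 0 →
        (m' = 0 → a ∈ maximalIdeal B) →
        ∃ y ∈ Ideal.span (coneMonomials 𝒜 σ s χ),
          (y : B) = a * ∏ j, ((s j : invariantSubring σ) : B) ^ m' j)
    (a : B) (c : ι) (haA : a ∈ invariantSubring σ) (hac : a ∈ 𝒜 c)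
    (hdeg : c + ∑ j, m j • χ j = 0) (h𝔪 : m = 0 → a ∈ maximalIdeal B) :
    ∃ y ∈ Ideal.span (coneMonomials 𝒜 σ s χ),
      (y : B) = a * ∏ j, ((s j : invariantSubring σ) : B) ^ m j := by
  classical
  set N := Fintype.card ι with hN
  set f : Fin d → B := fun j => ((s j : invariantSubring σ) : B) with hf
  have hNpos : 0 < N := Fintype.card_pos
  by_cases hbig : ∃ i, N ≤ m i
  · -- PEEL off the generator `f i ^ N`
    obtain ⟨i, hi⟩ := hbig
    set m' : Fin d → ℕ := fun j => if j = i then m j - N else m j with hm'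
    have hmm' : ∀ j, m j = m' j + if j = i then N else 0 := by
      intro j
      by_cases hji : j = i
      · subst hji; simp [hm', Nat.sub_add_cancel hi]
      · simp [hm', hji]
    have hprod : ∏ j, f j ^ m j = (∏ j, f j ^ m' j) * f i ^ N := by
      rw [← prod_pow_add_ite]
      exact Finset.prod_congr rfl fun j _ => by rw [← hmm' j]
    have hdeg' : c + ∑ j, m' j • χ j = 0 := by
      have h1 : ∑ j, m j • χ j = ∑ j, m' j • χ j + N • χ i := by
        rw [← sum_add_ite_smul]
        exact Finset.sum_congr rfl fun j _ => by rw [← hmm' j]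
      rw [h1, hN, card_nsmul_eq_zero, add_zero] at hdeg
      exact hdeg
    have hu0 : a * ∏ j, f j ^ m' j ∈ 𝒜 0 := by
      have := SetLike.mul_mem_graded hac (prod_pow_mem_graded_of 𝒜 σ s χ hs m')
      rwa [hdeg'] at this
    have huA : a * ∏ j, f j ^ m' j ∈ invariantSubring σ :=
      Subring.mul_mem _ haA (prod_pow_mem_invariantSubring σ s m')
    have ht0 : f i ^ N ∈ 𝒜 0 := by
      have := SetLike.pow_mem_graded N (hs i)
      rwa [hN, card_nsmul_eq_zero] at this
    have htA : f i ^ N ∈ invariantSubring σ := Subring.pow_mem _ (s i).2 _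
    have htT : (⟨f i ^ N, ht0, htA⟩ : degZeroInvariants 𝒜 σ) ∈ coneMonomials 𝒜 σ s χ := by
      refine ⟨fun j => if j = i then N else 0, ?_, ?_, ?_⟩
      · intro h0
        have := congr_fun h0 i
        simp only [if_true, Pi.zero_apply] at this
        exact absurd this hNpos.ne'
      · simp [ite_smul, hN]
      · show f i ^ N = ∏ j, f j ^ (if j = i then N else 0)
        simp [pow_ite, Finset.prod_ite_eq']
    refine ⟨⟨a * ∏ j, f j ^ m' j, hu0, huA⟩ * ⟨f i ^ N, ht0, htA⟩,
      Ideal.mul_mem_left _ _ (Ideal.subset_span htT), ?_⟩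
    show (a * ∏ j, f j ^ m' j) * f i ^ N = a * ∏ j, f j ^ m j
    rw [hprod, mul_assoc]
  · simp only [not_exists, not_le] at hbig
    by_cases hker : m ≠ 0 ∧ ∑ j, m j • χ j = 0
    · -- GENERATOR: `f^m ∈ T`, `c = 0`
      have hc : c = 0 := by rw [hker.2, add_zero] at hdeg; exact hdeg
      subst hc
      have hp0 : ∏ j, f j ^ m j ∈ 𝒜 0 := by
        have := prod_pow_mem_graded_of 𝒜 σ s χ hs m
        rwa [hker.2] at this
      have hpT : (⟨∏ j, f j ^ m j, hp0, prod_pow_mem_invariantSubring σ s m⟩ :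
          degZeroInvariants 𝒜 σ) ∈ coneMonomials 𝒜 σ s χ := ⟨m, hker.1, hker.2, rfl⟩
      exact ⟨⟨a, hac, haA⟩ * _, Ideal.mul_mem_left _ _ (Ideal.subset_span hpT), rfl⟩
    · -- EXPAND: `a ∈ 𝔪_B`, write `a = ∑ b i * f i` with `b i ∈ A` homogeneous, recurse
      have ha𝔪 : a ∈ maximalIdeal B := by
        by_cases hm0 : m = 0
        · exact h𝔪 hm0
        · have hne : ∑ j, m j • χ j ≠ 0 := fun h => hker ⟨hm0, h⟩
          have hc : c ≠ 0 := by
            intro hc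
            apply hne
            rw [hc, zero_add] at hdeg
            exact hdeg
          exact hR c hc a hac
      have haA𝔪 : (⟨a, haA⟩ : invariantSubring σ) ∈ maximalIdeal (invariantSubring σ) :=
        (mem_maximalIdeal_invariantSubring_iff σ _).2 ha𝔪
      rw [← hspan, Ideal.mem_span_range_iff_exists_fun] at haA𝔪
      obtain ⟨cf, hcf⟩ := haA𝔪
      have hcfB : ∑ i, (cf i : B) * f i = a := by
        have := congr_arg Subtype.val hcf
        simpa [hf] using this
      set b : Fin d → B := fun i => (decompose 𝒜 (cf i : B) (c - χ i) : B) with hb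
      have hbA : ∀ i, b i ∈ invariantSubring σ := fun i =>
        coe_decompose_mem_invariantSubring 𝒜 σ hσ (cf i).2 _
      have hbdeg : ∀ i, b i ∈ 𝒜 (c - χ i) := fun i => (decompose 𝒜 _ _).2
      have hab : a = ∑ i, b i * f i := by
        have h1 : a = GradedRing.proj 𝒜 c a := by
          rw [GradedRing.proj_apply, decompose_of_mem_same 𝒜 hac]
        rw [h1]
        conv_lhs => rw [← hcfB]
        rw [map_sum]
        refine Finset.sum_congr rfl fun i _ => ?_
        rw [GradedRing.proj_apply]
        have hc' : c = (c - χ i) + χ i := (sub_add_cancel c (χ i)).symm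
        conv_lhs => rw [hc']
        exact coe_decompose_mul_add_of_right_mem 𝒜 (hs i)
      have hrec : ∀ i : Fin d, ∃ y ∈ Ideal.span (coneMonomials 𝒜 σ s χ),
          (y : B) = b i * ∏ j, f j ^ (m j + if j = i then 1 else 0) := by
        intro i
        refine ih (fun j => m j + if j = i then 1 else 0) ?_ (b i) (c - χ i) (hbA i) (hbdeg i)
          ?_ ?_
        · have hsum : ∑ j, (m j + if j = i then 1 else 0) = ∑ j, m j + 1 := sum_add_ite m i 1
          have hle : ∑ j, m j ≤ d * (N - 1) := by
            calc ∑ j, m j ≤ ∑ _j : Fin d, (N - 1) :=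
                  Finset.sum_le_sum fun j _ => Nat.le_sub_one_of_lt (hbig j)
              _ = d * (N - 1) := by simp
          have hdpos : 0 < d := Fin.pos i
          have h1 : d * (N - 1) = d * N - d := Nat.mul_sub_one d N
          have h2 : d ≤ d * N := Nat.le_mul_of_pos_right d hNpos
          have h3 : N * d = d * N := mul_comm _ _
          rw [hsum]
          omega
        · rw [sum_add_ite_smul, one_nsmul, sub_add_add_cancel]
          exact hdeg
        · intro h0
          have := congr_fun h0 i
          simp at this
      choose y hyT hy using hrec
      refine ⟨∑ i, y i, Ideal.sum_mem _ fun i _ => hyT i, ?_⟩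
      rw [AddSubmonoidClass.coe_finsetSum]
      simp_rw [hy, prod_pow_add_ite, pow_one, hab, Finset.sum_mul]
      exact Finset.sum_congr rfl fun i _ => by ring

/-- The descending induction. [OURS · L1 W4.5c] -/
theorem exists_mem_span_coneMonomials [IsLocalRing (invariantSubring σ)]
    (hσ : ∀ c : ι, ∀ b ∈ 𝒜 c, σ b ∈ 𝒜 c)
    (hR : ∀ c : ι, c ≠ 0 → ∀ b ∈ 𝒜 c, b ∈ maximalIdeal B)
    (hs : ∀ i, ((s i : invariantSubring σ) : B) ∈ 𝒜 (χ i))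
    (hspan : Ideal.span (Set.range s) = maximalIdeal (invariantSubring σ)) (n : ℕ) :
    ∀ m : Fin d → ℕ, Fintype.card ι * d - ∑ j, m j = n →
      ∀ (a : B) (c : ι), a ∈ invariantSubring σ → a ∈ 𝒜 c → c + ∑ j, m j • χ j = 0 →
        (m = 0 → a ∈ maximalIdeal B) →
        ∃ y ∈ Ideal.span (coneMonomials 𝒜 σ s χ),
          (y : B) = a * ∏ j, ((s j : invariantSubring σ) : B) ^ m j := by
  induction n using Nat.strong_induction_on with
  | _ n ihn =>
    intro m hm a c haA hac hdeg h𝔪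
    exact coneMonomials_step 𝒜 σ s χ hσ hR hs hspan m
      (fun m' hlt => ihn _ (hm ▸ hlt) m' rfl) a c haA hac hdeg h𝔪

/-- **[D] (hard inclusion).** `𝔪_{A₀} ⊆ (cone monomials)`. [OURS · L1 W4.5c] -/
theorem maximalIdeal_degZeroInvariants_le_span [IsLocalRing (invariantSubring σ)]
    [IsLocalRing (degZeroInvariants 𝒜 σ)]
    (hσ : ∀ c : ι, ∀ b ∈ 𝒜 c, σ b ∈ 𝒜 c)
    (hR : ∀ c : ι, c ≠ 0 → ∀ b ∈ 𝒜 c, b ∈ maximalIdeal B)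
    (hs : ∀ i, ((s i : invariantSubring σ) : B) ∈ 𝒜 (χ i))
    (hspan : Ideal.span (Set.range s) = maximalIdeal (invariantSubring σ)) :
    maximalIdeal (degZeroInvariants 𝒜 σ) ≤ Ideal.span (coneMonomials 𝒜 σ s χ) := by
  intro x hx
  have hxB : (x : B) ∈ maximalIdeal B := (mem_maximalIdeal_degZeroInvariants_iff 𝒜 σ hσ x).1 hx
  obtain ⟨y, hy, hyx⟩ := exists_mem_span_coneMonomials 𝒜 σ s χ hσ hR hs hspan _ 0 rfl (x : B) 0
    x.2.2 x.2.1 (by simp) (fun _ => hxB)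
  have : y = x := Subtype.ext (by simpa using hyx)
  exact this ▸ hy

omit [Fintype ι] in
/-- **[D] (easy inclusion).** Cone monomials are non-units of `A₀`. [OURS · L1 W4.5c] -/
theorem span_coneMonomials_le_maximalIdeal [IsLocalRing (invariantSubring σ)]
    [IsLocalRing (degZeroInvariants 𝒜 σ)]
    (hσ : ∀ c : ι, ∀ b ∈ 𝒜 c, σ b ∈ 𝒜 c)
    (hspan : Ideal.span (Set.range s) = maximalIdeal (invariantSubring σ)) :
    Ideal.span (coneMonomials 𝒜 σ s χ) ≤ maximalIdeal (degZeroInvariants 𝒜 σ) := by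
  rw [Ideal.span_le]
  rintro y ⟨m, hm0, -, hy⟩
  rw [SetLike.mem_coe, mem_maximalIdeal_degZeroInvariants_iff 𝒜 σ hσ, hy]
  obtain ⟨i, hi⟩ : ∃ i, m i ≠ 0 := by
    by_contra h
    simp only [not_exists, not_not] at h
    exact hm0 (funext h)
  have hsi : ((s i : invariantSubring σ) : B) ∈ maximalIdeal B := by
    rw [← mem_maximalIdeal_invariantSubring_iff σ, ← hspan]
    exact Ideal.subset_span ⟨i, rfl⟩
  rw [Finset.prod_eq_mul_prod_sdiff_singleton_of_mem (Finset.mem_univ i)]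
  exact Ideal.mul_mem_right _ _ (Ideal.pow_mem_of_mem _ hsi _ (Nat.pos_of_ne_zero hi))

/-- **[D].** The maximal ideal of `A₀ = B₀^σ` is generated by the non-trivial cone monomials.
[OURS · L1 W4.5c] -/
theorem span_coneMonomials_eq_maximalIdeal [IsLocalRing (invariantSubring σ)]
    [IsLocalRing (degZeroInvariants 𝒜 σ)]
    (hσ : ∀ c : ι, ∀ b ∈ 𝒜 c, σ b ∈ 𝒜 c)
    (hR : ∀ c : ι, c ≠ 0 → ∀ b ∈ 𝒜 c, b ∈ maximalIdeal B)
    (hs : ∀ i, ((s i : invariantSubring σ) : B) ∈ 𝒜 (χ i))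
    (hspan : Ideal.span (Set.range s) = maximalIdeal (invariantSubring σ)) :
    Ideal.span (coneMonomials 𝒜 σ s χ) = maximalIdeal (degZeroInvariants 𝒜 σ) :=
  le_antisymm (span_coneMonomials_le_maximalIdeal 𝒜 σ s χ hσ hspan)
    (maximalIdeal_degZeroInvariants_le_span 𝒜 σ s χ hσ hR hs hspan)

end KatoIdeal

end Summit.ResolutionOfSingularities.ResolutionOfSingularities.Theorems.WildQuotientResolution.S1.LogExitFrames
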